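import Summits.Ventures.GridStability.Models.WSCC9FaultOn
import Literature.Analysis.ODE.SecondOrderBoxEnclosure
import Mathlib.Analysis.Complex.Trigonometric

/-!
# WSCC9FaultOnTube — kernel a-priori TUBE for the fault-on motion «bus 7 grounded» of the WSCC 3-machine classical model (line «G1cct-WSCC9-THRESH-K», box (1))

Venture GRIDFUSION (LADDER-GRIDFUSION G1-cct; lead g4 2026-08-27T07:24:26Z GO (1): «model-1 — fault-on TUBE
theorem on WSCC9FaultOn (p507827) with model-4's (B, lo, hi) via lit-1 secondOrder_tube_of_box_bounds»),
seat gridfusion-model-1.  DATA custody gridfusion-model-4 (g9): `bench/data/WSCC9/faulton-bus7-h12.json`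
500155fa0efdac9c (network, P′, windows) and `faulton-bus7-tube.json` bc6ee8ec5ef5d605 (the VALIDATED / exact
tube the kernel statement below re-derives with slightly wider, outward-rounded literals).

FRAME.  The tube runs in the PRINTED frame (speeds `ω_i = dδ_i/dt − ω_R`, `ω_i(0) = 0` at fault inception,
mechanical inputs `P′_i`): `WSCC9.faultBus7Printed` — the SAME network as `WSCC9.faultBus7` (p507827, frame of
the instance of record `v = ω − ω∞′`) with `P := Pprinted = e + D_SP·ω∞′` (`faultBus7_printedPower`); the two
records have the same `P_e` (`faultBus7Printed_Pe`).  The drift-free frame keeps the angle box tight; the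
clearing state in the v-frame is `v_i = ω_i − ω∞′` (one subtraction for the «K ⊂ S» consumer).

STATEMENT (`faultBus7_tube`): for every `T ∈ [0, 1/12]`, every fault-on solution `Y` of `faultBus7Printed` on
`[0, T]` with `ω(0) = 0` and pre-fault relative angles `δ₂(0) − δ₁(0) ∈ a2Window = [0.30468, 0.30478]`,
`δ₃(0) − δ₁(0) ∈ a3Window = [0.19025, 0.19035]` (A–F printed 2.2717°, 19.7315°, 13.1752°), and every
`t ∈ [0, T]`, machine-wise (Lean indices 0, 1, 2 = machines 1, 2, 3):
`lo_i t ≤ ω_i(t) ≤ hi_i t` and `lo_i t²/2 ≤ δ_i(t) − δ_i(0) ≤ hi_i t²/2` with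
`lo = (131/500, 11797/250, 5997/250) = (0.262, 47.188, 23.988)` and
`hi = (223/250, 48009/1000, 29611/1000) = (0.892, 48.009, 29.611)` rad/s² (`tubeLo`, `tubeHi`).
Hence the clearing state at ANY `t_cl ≤ 1/12 s` lies in the box `K(t_cl) ⊆ K(1/12)`:
`a2 ∈ a2⁰ + [lo₂ − hi₁, hi₂ − lo₁]·t²/2`, `a3 ∈ a3⁰ + [lo₃ − hi₁, hi₃ − lo₁]·t²/2`, `ω_i ∈ [lo_i, hi_i]·t`.

METHOD = lit-1's `Literature.Analysis.ODE.secondOrder_tube_of_solution` (p501879; Moore 1979 §8.1 a-priori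
enclosure by continuous induction) with KERNEL FIELD BOUNDS on the coordinate box
`B = [−0.001, 0.004] × [0.3, 0.48] × [0.19, 0.3] (angles, reference angle translated to 0) ×
[−0.001, 0.08] × [−0.001, 4.1] × [−0.001, 2.5] (speeds)` (`faultBus7Printed_fieldBounds`): on `B` the angle
difference `a3 = δ₃ − δ₁ ∈ [0.186, 0.301]`, `P^F_{e,1} = 0.733233515479 − 0.677570171284 sin a3 +
0.075376559101 cos a3` is decreasing, `P^F_{e,3} = 0.179988582327 + 0.677570171284 sin a3 + 0.075376559101 cos a3`
increasing, `P^F_{e,2} ≡ 0` (machine 2 isolated), with `sin`/`cos` enclosed at the endpoints by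
`Real.sin_bound` / `Real.cos_bound`; the four strict inclusions `K(1/12) ⊂ int B` are rational inequalities.
THREE COLUMNS: CERTIFIED = the tube sentence for MODEL M′ (MODELLED: classical WSCC9, MV-2 + MV-P + MV-SPD +
MV-h12, bolted fault at bus 7, pre-fault point = the printed angles ± 5e-5 rad at synchronous speed);
VALIDATED = model-4's exact tube (lo = (0.287134, 47.208373, 24.526891), hi = (0.837410, 48.008594, 29.299751)
on its narrower box) — consistent, mine is wider by construction.  No stability claim.
[cite: Moore1979, §8.1 eqs. (8.5), (8.10); AndersonFouad1977, Example 2.6 / §2.10]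
-/

noncomputable section

open Real Set Finset

namespace Summit.Ventures.GridStability.Models

namespace WSCC9

/-- The FAULT-ON model «bus 7 grounded» in the PRINTED frame: same machines and faulted network as
`faultBus7`, mechanical inputs `P′` (printed dispatch), speeds `ω = dδ/dt − ω_R` (so `ω(0) = 0` at fault
inception). MODELLED: MV-2 + MV-P + MV-SPD + MV-h12; bolted fault at bus 7 (A–F Ex. 2.6). -/
def faultBus7Printed : ClassicalSwing 3 where
  M i := (M i : ℝ)
  D i := (D_SP i : ℝ)
  P i := (Pprinted i : ℝ)
  E i := (E i : ℝ)
  G i j := (G_fault7 i j : ℝ)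
  B i j := (B_fault7 i j : ℝ)

/-- Same electrical powers as the v-frame record `faultBus7` (same `E`, `G`, `B`). -/
theorem faultBus7Printed_Pe (δ : Fin 3 → ℝ) (i : Fin 3) : faultBus7Printed.Pe δ i = faultBus7.Pe δ i := rfl

/-- The speed equation of the printed frame: `ω̇_i = (P′_i − P^F_{e,i}(δ) − D_i ω_i)/M_i`. -/
theorem faultBus7Printed_field_snd (x : ClassicalSwing.State 3) (i : Fin 3) :
    (faultBus7Printed.field x).2 i = ((Pprinted i : ℝ) - faultBus7.Pe x.1 i - (D_SP i : ℝ) * x.2 i) / (M i : ℝ) :=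
  rfl

/-- Lower acceleration bounds of the tube (rad/s²), machines 1, 2, 3: `(0.262, 47.188, 23.988)`. -/
def tubeLo : Fin 3 → ℝ := ![131 / 500, 11797 / 250, 5997 / 250]

/-- Upper acceleration bounds of the tube (rad/s²), machines 1, 2, 3: `(0.892, 48.009, 29.611)`. -/
def tubeHi : Fin 3 → ℝ := ![223 / 250, 48009 / 1000, 29611 / 1000]

/-- Angle box of the field-bound region `B` (reference angle translated to `0`): lower corners. -/
def boxA : Fin 3 → ℝ := ![-1 / 1000, 3 / 10, 19 / 100]
/-- Angle box of `B`: upper corners. -/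
def boxB : Fin 3 → ℝ := ![1 / 250, 12 / 25, 3 / 10]
/-- Speed box of `B`: lower corners. -/
def boxC : Fin 3 → ℝ := ![-1 / 1000, -1 / 1000, -1 / 1000]
/-- Speed box of `B`: upper corners. -/
def boxD : Fin 3 → ℝ := ![2 / 25, 41 / 10, 5 / 2]

/-- Electrical powers are invariant under a common shift of all angles (only differences enter). -/
theorem Pe_add_const (p : ClassicalSwing 3) (δ : Fin 3 → ℝ) (r : ℝ) (i : Fin 3) :
    p.Pe (fun j => δ j + r) i = p.Pe δ i := by
  simp only [ClassicalSwing.Pe, add_sub_add_right_eq_sub]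

/-- `sin` and `cos` enclosures on `[0.186, 0.301]` (monotonicity + `Real.sin_bound` / `Real.cos_bound`). -/
theorem trig_bounds_a3 {s : ℝ} (hs : s ∈ Icc (93 / 500 : ℝ) (301 / 1000)) :
    (0.1849 : ℝ) ≤ Real.sin s ∧ Real.sin s ≤ 0.2965 ∧ (0.954 : ℝ) ≤ Real.cos s ∧ Real.cos s ≤ 0.9828 := by
  obtain ⟨h1, h2⟩ := hs
  have hπ := Real.pi_gt_three
  have hsin_lo : Real.sin (93 / 500) ≤ Real.sin s :=
    Real.sin_le_sin_of_le_of_le_pi_div_two (by linarith) (by linarith) h1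
  have hsin_hi : Real.sin s ≤ Real.sin (301 / 1000) :=
    Real.sin_le_sin_of_le_of_le_pi_div_two (by linarith) (by linarith) h2
  have hcos_hi : Real.cos s ≤ Real.cos (93 / 500) :=
    Real.cos_le_cos_of_nonneg_of_le_pi (by norm_num) (by linarith) h1
  have hcos_lo : Real.cos (301 / 1000) ≤ Real.cos s :=
    Real.cos_le_cos_of_nonneg_of_le_pi (by linarith) (by linarith) h2
  have b1 := Real.sin_bound (x := (93 / 500 : ℝ)) (by rw [abs_of_nonneg (by norm_num)]; norm_num)
  have b2 := Real.sin_bound (x := (301 / 1000 : ℝ)) (by rw [abs_of_nonneg (by norm_num)]; norm_num)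
  have b3 := Real.cos_bound (x := (93 / 500 : ℝ)) (by rw [abs_of_nonneg (by norm_num)]; norm_num)
  have b4 := Real.cos_bound (x := (301 / 1000 : ℝ)) (by rw [abs_of_nonneg (by norm_num)]; norm_num)
  rw [abs_of_nonneg (by norm_num : (0 : ℝ) ≤ 93 / 500)] at b1 b3
  rw [abs_of_nonneg (by norm_num : (0 : ℝ) ≤ 301 / 1000)] at b2 b4
  obtain ⟨b1l, b1u⟩ := abs_le.1 b1
  obtain ⟨b2l, b2u⟩ := abs_le.1 b2
  obtain ⟨b3l, b3u⟩ := abs_le.1 b3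
  obtain ⟨b4l, b4u⟩ := abs_le.1 b4
  norm_num at b1l b1u b2l b2u b3l b3u b4l b4u ⊢
  refine ⟨by linarith, by linarith, by linarith, by linarith⟩

/-- **Kernel field bounds on the box `B`.** For every state with angles in `[boxA, boxB]` (reference
translated to `0`) and speeds in `[boxC, boxD]`, the accelerations of `faultBus7Printed` lie in
`[tubeLo, tubeHi]`. -/
theorem faultBus7Printed_fieldBounds (x : ClassicalSwing.State 3)
    (hx : ∀ i, boxA i ≤ x.1 i ∧ x.1 i ≤ boxB i ∧ boxC i ≤ x.2 i ∧ x.2 i ≤ boxD i) :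
    ∀ i, tubeLo i ≤ (faultBus7Printed.field x).2 i ∧ (faultBus7Printed.field x).2 i ≤ tubeHi i := by
  have h0 := hx 0
  have h1 := hx 1
  have h2 := hx 2
  simp only [boxA, boxB, boxC, boxD, Matrix.cons_val_zero, Matrix.cons_val_one, Matrix.head_cons,
    Matrix.cons_val_two, Matrix.tail_cons] at h0 h1 h2
  -- the angle difference a3 = x.1 2 − x.1 0 ∈ [0.186, 0.301]
  have ha3 : x.1 2 - x.1 0 ∈ Icc (93 / 500 : ℝ) (301 / 1000) := ⟨by linarith, by linarith⟩
  obtain ⟨hs1, hs2, hc1, hc2⟩ := trig_bounds_a3 ha3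
  have hsin' : Real.sin (x.1 0 - x.1 2) = -Real.sin (x.1 2 - x.1 0) := by
    rw [← Real.sin_neg]; ring_nf
  have hcos' : Real.cos (x.1 0 - x.1 2) = Real.cos (x.1 2 - x.1 0) := by
    rw [← Real.cos_neg]; ring_nf
  have hm0 : tubeLo 0 ≤ (faultBus7Printed.field x).2 0 ∧ (faultBus7Printed.field x).2 0 ≤ tubeHi 0 := by
    rw [faultBus7Printed_field_snd, faultBus7_Pe_zero, hsin', hcos']
    simp only [tubeLo, tubeHi, Pprinted, D_SP, M, Matrix.cons_val_zero]
    push_cast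
    constructor
    · rw [le_div_iff₀ (by norm_num)]; nlinarith
    · rw [div_le_iff₀ (by norm_num)]; nlinarith
  have hm1 : tubeLo 1 ≤ (faultBus7Printed.field x).2 1 ∧ (faultBus7Printed.field x).2 1 ≤ tubeHi 1 := by
    rw [faultBus7Printed_field_snd, faultBus7_Pe_one]
    simp only [tubeLo, tubeHi, Pprinted, D_SP, M, Matrix.cons_val_one]
    push_cast
    constructor
    · rw [le_div_iff₀ (by norm_num)]; nlinarith
    · rw [div_le_iff₀ (by norm_num)]; nlinarith
  have hm2 : tubeLo 2 ≤ (faultBus7Printed.field x).2 2 ∧ (faultBus7Printed.field x).2 2 ≤ tubeHi 2 := by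
    rw [faultBus7Printed_field_snd, faultBus7_Pe_two]
    simp only [tubeLo, tubeHi, Pprinted, D_SP, M, Matrix.cons_val_two, Matrix.tail_cons,
      Matrix.head_cons]
    push_cast
    constructor
    · rw [le_div_iff₀ (by norm_num)]; nlinarith
    · rw [div_le_iff₀ (by norm_num)]; nlinarith
  intro i
  fin_cases i
  · exact hm0
  · exact hm1
  · exact hm2

/-- **THE FAULT-ON TUBE («bus 7 grounded», printed frame, every `T ≤ 1/12 s`).**  For every `T ∈ [0, 1/12]`,
every solution `Y` of `faultBus7Printed` on `[0, T]` starting at synchronous speed (`ω(0) = 0`) from the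
printed pre-fault relative angles (`δ₂(0) − δ₁(0) ∈ a2Window`, `δ₃(0) − δ₁(0) ∈ a3Window`; the absolute
reference angle is free), and every `t ∈ [0, T]`: `tubeLo_i·t ≤ ω_i(t) ≤ tubeHi_i·t` and
`tubeLo_i·t²/2 ≤ δ_i(t) − δ_i(0) ≤ tubeHi_i·t²/2` (`i` = machine 1, 2, 3).  MODELLED: classical WSCC9 fault-on
model M′ (MV-2 + MV-P + MV-SPD + MV-h12).  [cite: Moore1979, §8.1 eqs. (8.5), (8.10); AndersonFouad1977,
Example 2.6] -/
theorem faultBus7_tube {T : ℝ} (hT0 : 0 ≤ T) (hT : T ≤ 1 / 12) {Y : ℝ → ClassicalSwing.State 3}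
    (hY : faultBus7Printed.IsSolutionOn Y (Icc 0 T)) (hω0 : (Y 0).2 = 0)
    (ha2 : (Y 0).1 1 - (Y 0).1 0 ∈ a2Window) (ha3 : (Y 0).1 2 - (Y 0).1 0 ∈ a3Window) :
    ∀ t ∈ Icc 0 T, ∀ i : Fin 3,
      tubeLo i * t ≤ (Y t).2 i ∧ (Y t).2 i ≤ tubeHi i * t ∧
        tubeLo i * t ^ 2 / 2 ≤ (Y t).1 i - (Y 0).1 i ∧ (Y t).1 i - (Y 0).1 i ≤ tubeHi i * t ^ 2 / 2 := by
  -- translate the reference angle to 0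
  set r : ℝ := (Y 0).1 0 with hr
  set X : ℝ → ClassicalSwing.State 3 := fun t => (fun j => (Y t).1 j - r, (Y t).2) with hX
  have hfieldX : ∀ t, faultBus7Printed.field (X t) = faultBus7Printed.field (Y t) := by
    intro t
    have hPe : ∀ i, faultBus7Printed.Pe (fun j => (Y t).1 j - r) i = faultBus7Printed.Pe (Y t).1 i := by
      intro i
      have := Pe_add_const faultBus7Printed (Y t).1 (-r) i
      simpa [sub_eq_add_neg] using this
    ext i
    · rfl
    · simp only [ClassicalSwing.field, hX, hPe]
  have hXsol : ∀ t ∈ Icc 0 T, HasDerivWithinAt X (faultBus7Printed.field (X t)) (Icc 0 T) t := by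
    intro t ht
    rw [hfieldX]
    have h := hY t ht
    have hc : HasDerivWithinAt (fun _ : ℝ => ((fun _ : Fin 3 => r), (0 : Fin 3 → ℝ)))
        (0 : ClassicalSwing.State 3) (Icc 0 T) t := hasDerivWithinAt_const _ _ _
    have h2 := h.sub hc
    rw [sub_zero] at h2
    refine h2.congr (fun s _ => ?_) ?_ <;> (ext i <;> simp [hX])
  -- the tube theorem on X
  have hX0ω : (X 0).2 = 0 := by simp [hX, hω0]
  have hX01 : (X 0).1 0 = 0 := by simp [hX, hr]
  have hX02 : (X 0).1 1 = (Y 0).1 1 - (Y 0).1 0 := by simp [hX, hr]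
  have hX03 : (X 0).1 2 = (Y 0).1 2 - (Y 0).1 0 := by simp [hX, hr]
  obtain ⟨ha2l, ha2u⟩ := ha2
  obtain ⟨ha3l, ha3u⟩ := ha3
  have hT2 : T ^ 2 ≤ (1 / 12 : ℝ) ^ 2 := pow_le_pow_left₀ hT0 hT 2
  -- the four strict inclusions K(T) ⊂ int B
  have hlo0 : (0 : ℝ) < tubeLo 0 ∧ (0 : ℝ) < tubeLo 1 ∧ (0 : ℝ) < tubeLo 2 := by
    simp only [tubeLo, Matrix.cons_val_zero, Matrix.cons_val_one, Matrix.head_cons, Matrix.cons_val_two,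
      Matrix.tail_cons]; norm_num
  have hhi0 : (0 : ℝ) < tubeHi 0 ∧ (0 : ℝ) < tubeHi 1 ∧ (0 : ℝ) < tubeHi 2 := by
    simp only [tubeHi, Matrix.cons_val_zero, Matrix.cons_val_one, Matrix.head_cons, Matrix.cons_val_two,
      Matrix.tail_cons]; norm_num
  have hKa : ∀ i, boxA i < (X 0).1 i + min 0 ((X 0).2 i * T) + min (tubeLo i) 0 * T ^ 2 / 2 := by
    have e : ∀ i, (X 0).1 i + min 0 ((X 0).2 i * T) + min (tubeLo i) 0 * T ^ 2 / 2 = (X 0).1 i := by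
      intro i
      rw [hX0ω, Pi.zero_apply, zero_mul, min_self, add_zero]
      have : min (tubeLo i) 0 = 0 := by
        fin_cases i
        · exact min_eq_right hlo0.1.le
        · exact min_eq_right hlo0.2.1.le
        · exact min_eq_right hlo0.2.2.le
      rw [this]; ring
    intro i; rw [e]
    fin_cases i
    · show boxA 0 < (X 0).1 0
      rw [hX01]; norm_num [boxA]
    · show boxA 1 < (X 0).1 1
      rw [hX02]; norm_num [boxA] at ha2l ⊢; linarith
    · show boxA 2 < (X 0).1 2
      rw [hX03]; norm_num [boxA, Matrix.cons_val_two, Matrix.tail_cons, Matrix.head_cons] at ha3l ⊢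
      linarith
  have hKb : ∀ i, (X 0).1 i + max 0 ((X 0).2 i * T) + max (tubeHi i) 0 * T ^ 2 / 2 < boxB i := by
    have e : ∀ i, (X 0).1 i + max 0 ((X 0).2 i * T) + max (tubeHi i) 0 * T ^ 2 / 2 =
        (X 0).1 i + tubeHi i * T ^ 2 / 2 := by
      intro i
      rw [hX0ω, Pi.zero_apply, zero_mul, max_self, add_zero]
      have : max (tubeHi i) 0 = tubeHi i := by
        fin_cases i
        · exact max_eq_left hhi0.1.le
        · exact max_eq_left hhi0.2.1.le
        · exact max_eq_left hhi0.2.2.le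
      rw [this]
    intro i; rw [e]
    fin_cases i
    · show (X 0).1 0 + tubeHi 0 * T ^ 2 / 2 < boxB 0
      rw [hX01]; norm_num [boxB, tubeHi] at hT2 ⊢; nlinarith [hT2]
    · show (X 0).1 1 + tubeHi 1 * T ^ 2 / 2 < boxB 1
      rw [hX02]; norm_num [boxB, tubeHi] at ha2u hT2 ⊢; nlinarith [hT2]
    · show (X 0).1 2 + tubeHi 2 * T ^ 2 / 2 < boxB 2
      rw [hX03]
      norm_num [boxB, tubeHi, Matrix.cons_val_two, Matrix.tail_cons, Matrix.head_cons] at ha3u hT2 ⊢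
      nlinarith [hT2]
  have hKc : ∀ i, boxC i < (X 0).2 i + min (tubeLo i) 0 * T := by
    intro i
    rw [hX0ω, Pi.zero_apply]
    fin_cases i
    · show boxC 0 < 0 + min (tubeLo 0) 0 * T
      rw [min_eq_right hlo0.1.le]; norm_num [boxC]
    · show boxC 1 < 0 + min (tubeLo 1) 0 * T
      rw [min_eq_right hlo0.2.1.le]; norm_num [boxC]
    · show boxC 2 < 0 + min (tubeLo 2) 0 * T
      rw [min_eq_right hlo0.2.2.le]
      norm_num [boxC, Matrix.cons_val_two, Matrix.tail_cons, Matrix.head_cons]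
  have hKd : ∀ i, (X 0).2 i + max (tubeHi i) 0 * T < boxD i := by
    intro i
    rw [hX0ω, Pi.zero_apply, zero_add]
    fin_cases i
    · show max (tubeHi 0) 0 * T < boxD 0
      rw [max_eq_left hhi0.1.le]; norm_num [boxD, tubeHi]; nlinarith [hT]
    · show max (tubeHi 1) 0 * T < boxD 1
      rw [max_eq_left hhi0.2.1.le]; norm_num [boxD, tubeHi]; nlinarith [hT]
    · show max (tubeHi 2) 0 * T < boxD 2
      rw [max_eq_left hhi0.2.2.le]
      norm_num [boxD, tubeHi, Matrix.cons_val_two, Matrix.tail_cons, Matrix.head_cons]; nlinarith [hT]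
  have key := Literature.Analysis.ODE.secondOrder_tube_of_solution (F := faultBus7Printed.field)
    (fun _ => rfl) hT0 hXsol (lo := tubeLo) (hi := tubeHi) (a := boxA) (b := boxB) (c := boxC) (d := boxD)
    (fun x hx => faultBus7Printed_fieldBounds x hx) hKa hKb hKc hKd
  intro t ht i
  obtain ⟨k1, k2, k3, k4⟩ := key t ht i
  have e1 : (X t).2 i = (Y t).2 i := rfl
  have e2 : (X 0).2 i = 0 := by rw [hX0ω]; rfl
  have e3 : (X t).1 i - (X 0).1 i = (Y t).1 i - (Y 0).1 i := by
    show ((Y t).1 i - r) - ((Y 0).1 i - r) = _; ring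
  rw [e1, e2, sub_zero] at k1 k2
  rw [e3, e2, zero_mul, sub_zero] at k3 k4
  exact ⟨k1, k2, k3, k4⟩

end WSCC9

end Summit.Ventures.GridStability.Models

end
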